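import Summits.QuantumFields.YangMills.Theses.CutoffNotchTransport

/-!
# Assembly of route `CutoffNotchTransport` (rung R3 of LADDER-YM; ideator seat ym-r3-idea-2 g2, LINE 3)

The route file's kernel-checked deciding theorem `closes` packaged as the proof of the route's `Assembly` item:
`MinimiserStabilityRegPr → FluctuationComparisonRegPrIntL → NotchMomentRatioL → BareCappedMomentL → HistoryTailOfNotch → YM3TorusSU2`.
No summit and no Clay statement is proved here; the rung `YM3TorusSU2` itself stays open behind the open cruxes.
-/

namespace Summit.QuantumFields.YangMills.Theorems

open Summit.QuantumFields.YangMills.Theses.CutoffNotchTransport in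
/-- The `Assembly` item of route `CutoffNotchTransport` holds: it is the route's deciding theorem `closes` read as an implication. -/
theorem cutoffNotchTransport_assembly : Summit.QuantumFields.YangMills.Theses.CutoffNotchTransport.Assembly :=
  fun h200 h201 hN hB hG => closes h200 h201 hN hB hG

end Summit.QuantumFields.YangMills.Theorems
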